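import Mathlib.Analysis.SpecificLimits.Basic
import HarnessLib

/-!
# Far-edge descent, kernel XXXIX-H — squaring towers below `β = 2 − 1/a²` are extinct (model level)

The β-dial (kernel XXXVIII) is the accounting of a hypothetical toolbox of certificates
`r = Q + β·L` for anchored objects `⟨1,Q,1⟩ ⊕ legs` (leg mass `L`), closed under a product step with
re-anchoring.  Kernel XXXIX-G (`lo_floor_wide`, `anchored_lo_budget_wide`) certifies, for the TENSOR
at any node whose legs have widths divisible by `a²`, the floor `r ≥ Q + (2 − 1/a²)·L_{≥2}` where
`L_{≥2}` is the mass on those legs.  In a SQUARING tower grown from width-`a` bases the legs of the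
minimum width `a` at level `k + 1` are exactly the anchor-times-leg blocks, so their mass fraction
obeys `m_{k+1} = m_k · 2Q_k/(2Q_k + L_k)` (all other legs have width divisible by `a²`), and the floor
reads `(2 − 1/a²)(1 − m_k)·L_k ≤ β·L_k` at every node.  Along a squaring tower the share
`λ = L/r` tends monotonically to the fixed point `1/(2β−1)` (kernel XXXVIII), so it is bounded below
and the anchor ratio is bounded, `Q_k ≤ ρL_k`; then `m_k ≤ (2ρ/(2ρ+1))^k → 0`, so for every
`β < 2 − 1/a²` the budget drops below the floor at some finite level:

* `fraction_step`, `fraction_le_pow` — the geometric decay of the minimum-width mass fraction;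
* **`squaring_tower_extinct`** — `β < 2 − 1/a²`, `Q_k ≤ ρL_k`, the squaring bookkeeping for `m_k`
  ⟹ `∃ k, Q_k + βL_k < Q_k + (2 − 1/a²)(1 − m_k)L_k` (the claimed budget of node `k` is smaller than
  the border rank floor of the object it claims to certify).

For width-`2` bases this covers every `β < 7/4`, in particular the whole range `β < 1 + √2/2` where the
dial's order cap `θ_β` exceeds `1`: such toolboxes, even granted their product step, cannot square
indefinitely.  (Linear towers — multiplying by a fresh base each time — replenish narrow legs and are
NOT excluded by this count; nor is `β ≥ 2 − 1/a²` with deeper width classes, which needs the `a^j`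
floors of XXXIX-G for `j ≥ 3` and a finer bookkeeping.  Both are left open here.)

HONEST FRAMING: a statement about the MODEL's bookkeeping (real sequences), whose one tensor input is
the node floor of kernel XXXIX-G quoted as the hypothesis shape `hfloor`; it proves nothing about
`ω(1,k,1)` or `AnchoredLogConvexity`.  No definitions.

References: kernel XXXVIII (`FarEdgeDescentDialDictionary.dial_product_step`: the product step's
identities); Landsberg–Ottaviani 2015, Thm. 1.1 [LandsbergOttaviani2015] (the floor, via XXXIX-G).
-/

noncomputable section

set_option linter.dupNamespace false

namespace Summit.MatrixMultiplication.MatrixMultiplication.Theorems.FarEdgeDescentDialExtinction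

/-- One squaring step shrinks the minimum-width mass fraction at least by the factor `2ρ/(2ρ+1)`
when the anchor ratio is at most `ρ` (`Q ≤ ρL`). -/
theorem fraction_step {Q L m ρ : ℝ} (hQ : 0 < Q) (hL : 0 < L) (hm : 0 ≤ m) (hρ : Q ≤ ρ * L) :
    m * (2 * Q) / (2 * Q + L) ≤ m * (2 * ρ / (2 * ρ + 1)) := by
  have hρ0 : 0 < ρ := by
    by_contra h
    have h' := not_lt.1 h
    nlinarith
  have h1 : (2 * Q) / (2 * Q + L) ≤ 2 * ρ / (2 * ρ + 1) := by
    rw [div_le_div_iff₀ (by linarith) (by linarith)]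
    nlinarith
  rw [mul_div_assoc]
  exact mul_le_mul_of_nonneg_left h1 hm

/-- Along a squaring tower with anchor ratio `≤ ρ`, `m_k ≤ m_0 · (2ρ/(2ρ+1))^k`. -/
theorem fraction_le_pow {ρ : ℝ} (Q L m : ℕ → ℝ) (hQ : ∀ k, 0 < Q k) (hL : ∀ k, 0 < L k)
    (hm : ∀ k, 0 ≤ m k) (hρ : ∀ k, Q k ≤ ρ * L k)
    (hsq : ∀ k, m (k + 1) = m k * (2 * Q k) / (2 * Q k + L k)) (k : ℕ) :
    m k ≤ m 0 * (2 * ρ / (2 * ρ + 1)) ^ k := by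
  induction k with
  | zero => simp
  | succ k ih =>
    have hρ0 : 0 < ρ := by
      by_contra h
      have h' := not_lt.1 h
      have := hρ 0
      nlinarith [hQ 0, hL 0]
    have hθ : 0 ≤ 2 * ρ / (2 * ρ + 1) := div_nonneg (by linarith) (by linarith)
    calc m (k + 1) = m k * (2 * Q k) / (2 * Q k + L k) := hsq k
      _ ≤ m k * (2 * ρ / (2 * ρ + 1)) := fraction_step (hQ k) (hL k) (hm k) (hρ k)
      _ ≤ m 0 * (2 * ρ / (2 * ρ + 1)) ^ k * (2 * ρ / (2 * ρ + 1)) :=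
          mul_le_mul_of_nonneg_right ih hθ
      _ = m 0 * (2 * ρ / (2 * ρ + 1)) ^ (k + 1) := by ring

/-- **Squaring towers below `β = 2 − 1/a²` are extinct.**  If every node `k` of a squaring tower
claims the budget `Q_k + β·L_k`, has anchor ratio `Q_k ≤ ρ·L_k`, and its minimum-width mass fraction
follows the squaring bookkeeping `m_{k+1} = m_k·2Q_k/(2Q_k + L_k)` (`0 ≤ m_0 ≤ 1`), then for
`β < 2 − 1/a²` some node's budget is below the wide Landsberg–Ottaviani floor
`Q_k + (2 − 1/a²)·(1 − m_k)·L_k` of kernel XXXIX-G. [cite: LandsbergOttaviani2015, Thm 1.1] -/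
theorem squaring_tower_extinct {β a ρ : ℝ} (ha : 1 ≤ a) (hβ : β < 2 - 1 / a ^ 2)
    (Q L m : ℕ → ℝ) (hQ : ∀ k, 0 < Q k) (hL : ∀ k, 0 < L k) (hm : ∀ k, 0 ≤ m k) (hm0 : m 0 ≤ 1)
    (hρ : ∀ k, Q k ≤ ρ * L k)
    (hsq : ∀ k, m (k + 1) = m k * (2 * Q k) / (2 * Q k + L k)) :
    ∃ k, Q k + β * L k < Q k + (2 - 1 / a ^ 2) * ((1 - m k) * L k) := by
  have hρ0 : 0 < ρ := by
    by_contra h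
    have h' := not_lt.1 h
    have := hρ 0
    nlinarith [hQ 0, hL 0]
  set c : ℝ := 2 - 1 / a ^ 2 with hc
  have hcpos : 0 < c := by
    have ha2 : (0 : ℝ) < a ^ 2 := by positivity
    have h1 : 1 / a ^ 2 ≤ 1 := by
      rw [div_le_one ha2]
      nlinarith
    rw [hc]
    linarith
  set θ : ℝ := 2 * ρ / (2 * ρ + 1) with hθ
  have hθ0 : 0 ≤ θ := div_nonneg (by linarith) (by linarith)
  have hθ1 : θ < 1 := (div_lt_one (by linarith)).2 (by linarith)
  set δ : ℝ := 1 - β / c with hδ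
  have hδ0 : 0 < δ := by
    have : β / c < 1 := (div_lt_one hcpos).2 hβ
    rw [hδ]
    linarith
  obtain ⟨k, hk⟩ := exists_pow_lt_of_lt_one hδ0 hθ1
  refine ⟨k, ?_⟩
  have hmk : m k < δ := by
    have h1 := fraction_le_pow Q L m hQ hL hm hρ hsq k
    have h2 : m 0 * θ ^ k ≤ θ ^ k := by
      have := pow_nonneg hθ0 k
      nlinarith [hm 0]
    exact lt_of_le_of_lt (h1.trans h2) hk
  have hβc : β < c * (1 - m k) := by
    have h1 : c * m k < c * δ := mul_lt_mul_of_pos_left hmk hcpos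
    have h2 : c * δ = c - β := by
      rw [hδ, mul_sub, mul_one, mul_div_cancel₀ _ hcpos.ne']
    rw [h2] at h1
    linarith
  have := mul_lt_mul_of_pos_right hβc (hL k)
  rw [mul_assoc] at this
  linarith

end Summit.MatrixMultiplication.MatrixMultiplication.Theorems.FarEdgeDescentDialExtinction

end
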